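import Mathlib
import HarnessLib
import Summits.RiemannHypothesis.RiemannHypothesis.Theorems.RuelleBandAsymptoticCriticalLineLasotaYorkeEngine

/-!
# RuelleBand / `AsymptoticCriticalLine`: the Lasota–Yorke engine on a PRE-Hilbert space

Route `RiemannHypothesis/RuelleBand`, crux item stmt-RiemannHypothesis-2063
(`AsymptoticCriticalLine`, "ACL"), line `interior-edge-split`, helper file (`--supports`; registered
stub `asymptoticCriticalLine_of_lasotaYorkePreHilbert`). Everything is proved; no definitions.

WHAT. The landed engine `asymptoticCriticalLine_of_lasotaYorkeRealisation`
(`…LasotaYorkeEngine.lean`) derives the crux from Lasota–Yorke data on a COMPLETE complex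
inner-product space `H`: a weak seminorm `w` with finite `w`-nets of the unit ball, a semigroup
`T (t ≥ 0)` of bounded operators, the a-priori two-norm inequality
`‖(T t₀)ⁿ f‖ ≤ C_ε e^{n ε t₀} ‖f‖ + R_{n,ε} w(f)` for every `ε > 0`, and one-sided joint
eigenvectors `T t v = e^{t(ρ - 1/2)} v` at every zero `ρ` of `ζ` in the open strip. In the
programme item `MeyerLasotaYorke` (stmt-RiemannHypothesis-11050) the pinned strong norm lives on
Meyer's coinvariant space `H⁰₋(ℚ)`, an INCOMPLETE inner-product space, and the joint eigenvectors
are elements of that space. This file removes completeness from the engine's hypotheses: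

`asymptoticCriticalLine_of_lasotaYorkePreHilbert` — the same conclusion for data on a possibly
incomplete complex inner-product space `E`, under the (standard, harmless) extra hypothesis that
the weak seminorm is dominated by the norm, `w ≤ c ‖·‖`.

PROOF (transport to the Hilbert completion). Let `Ê` be the Hilbert-space completion of `E` and
`ι : E → Ê` the dense isometric embedding. (1) Each `T t` extends uniquely to a bounded operator
`T̂ t` on `Ê` with `T̂ t (ι f) = ι (T t f)` (`ContinuousLinearMap.extend`); two bounded operators
agreeing on the dense range of `ι` are equal, so the semigroup law and the power identity
`(T̂ t₀)ⁿ (ι f) = ι ((T t₀)ⁿ f)` transfer. (2) `w` is `c`-Lipschitz, hence uniformly continuous,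
so it extends to a continuous function `ŵ` on `Ê` with `ŵ ∘ ι = w`; subadditivity, absolute
homogeneity and the bound `ŵ ≤ c ‖·‖` are closed conditions and hold on the dense range, so `ŵ`
is a continuous seminorm on `Ê`. (3) Finite `ŵ`-nets of the unit ball of `Ê`: approximate
`x` (`‖x‖ ≤ 1`) by `ι f₁` within `δ`, rescale `f := (1 + δ)⁻¹ f₁` into the unit ball of `E`
(moving by at most `δ`), and use the `E`-net at level `η / 2`; the error `ŵ (x - ι f) ≤ 2 c δ` is
absorbed by the choice of `δ`. (4) The Lasota–Yorke inequality with the SAME constants is a closed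
condition in `x ∈ Ê` holding on the dense range. (5) `ι` is injective and linear, so joint
eigenvectors in `E` map to joint eigenvectors of `T̂` in `Ê`. (6) Apply the landed engine on `Ê`.

Sources: standard completion arguments (N. Bourbaki, *Topologie générale* II §3.6–3.7, extension
of uniformly continuous maps; *EVT* I §1.6); H. Hennion, Proc. AMS 118 (1993) 627–634 and
V. Baladi, *Positive transfer operators and decay of correlations* (2000) §2.3 for the two-norm
framework; R. Meyer, Duke Math. J. 127 (2005) for the coinvariant space.
-/

noncomputable section

-- D-0017: `Summit.<S>.<S>.…` is the designed namespace of a single-problem summit.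
set_option linter.dupNamespace false

namespace Summit.RiemannHypothesis.RiemannHypothesis.Theorems

open Complex Filter Topology UniformSpace
open Summit.RiemannHypothesis.RiemannHypothesis.Theses.RuelleBand

section CompletionTransport

variable {E : Type*} [NormedAddCommGroup E] [NormedSpace ℂ E]

/-- Two bounded operators on the completion `Ê` that agree on the dense range of `ι : E → Ê` are
equal. [folklore] -/
theorem clm_completion_eq_of_forall_coe {A B : Completion E →L[ℂ] Completion E}
    (h : ∀ f : E, A (f : Completion E) = B (f : Completion E)) : A = B :=
  ContinuousLinearMap.ext (Completion.ext' A.continuous B.continuous h)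

/-- The bounded extension of `ι ∘ A` to the completion restricts to `A`: `Â (ι f) = ι (A f)`.
[folklore] -/
theorem completion_extend_coe (A : E →L[ℂ] E) (f : E) :
    ((Completion.toComplL.comp A).extend (Completion.toComplL : E →L[ℂ] Completion E))
      (f : Completion E) = ((A f : E) : Completion E) :=
  ContinuousLinearMap.extend_eq (Completion.toComplL.comp A) Completion.denseRange_coe
    (Completion.isUniformInducing_coe E) f

/-- Powers of an extension: if `Â (ι f) = ι (A f)` for all `f`, then `Âⁿ (ι f) = ι (Aⁿ f)`.
[folklore] -/
theorem completion_pow_coe (A : E →L[ℂ] E) (B : Completion E →L[ℂ] Completion E)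
    (h : ∀ f : E, B (f : Completion E) = ((A f : E) : Completion E)) (n : ℕ) (f : E) :
    (B ^ n) (f : Completion E) = (((A ^ n) f : E) : Completion E) := by
  induction n generalizing f with
  | zero => rw [pow_zero, pow_zero, one_apply_eq_self, one_apply_eq_self]
  | succ k ih => rw [pow_succ, pow_succ, mul_apply_eq_comp, mul_apply_eq_comp, h, ih]

/-- A seminorm dominated by the norm, `w ≤ c ‖·‖`, is uniformly continuous. [folklore] -/
theorem uniformContinuous_seminorm_of_le_mul_norm (w : Seminorm ℂ E) {c : ℝ}
    (hwc : ∀ f : E, w f ≤ c * ‖f‖) : UniformContinuous w := by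
  refine (LipschitzWith.of_dist_le' (K := c) fun f g => ?_).uniformContinuous
  rw [Real.dist_eq, dist_eq_norm]
  exact (abs_sub_map_le_sub w f g).trans (hwc (f - g))

/-- A seminorm `w ≤ c ‖·‖` on `E` extends to a continuous seminorm `ŵ ≤ c ‖·‖` on the completion
with `ŵ (ι f) = w f`. [folklore] -/
theorem exists_seminorm_completion_extension (w : Seminorm ℂ E) {c : ℝ}
    (hwc : ∀ f : E, w f ≤ c * ‖f‖) :
    ∃ W : Seminorm ℂ (Completion E), Continuous W ∧ (∀ f : E, W (f : Completion E) = w f) ∧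
      ∀ x : Completion E, W x ≤ c * ‖x‖ := by
  have hwu : UniformContinuous w := uniformContinuous_seminorm_of_le_mul_norm w hwc
  have hcont : Continuous (Completion.extension w) := Completion.continuous_extension
  have hcoe : ∀ f : E, Completion.extension w (f : Completion E) = w f :=
    fun f => Completion.extension_coe hwu f
  have hadd : ∀ x y : Completion E, Completion.extension w (x + y) ≤
      Completion.extension w x + Completion.extension w y := by
    intro x y
    induction x, y using Completion.induction_on₂ with
    | hp =>
      exact isClosed_le (hcont.comp continuous_add)
        ((hcont.comp continuous_fst).add (hcont.comp continuous_snd))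
    | ih f g => rw [← Completion.coe_add, hcoe, hcoe, hcoe]; exact map_add_le_add w f g
  have hsmul : ∀ (a : ℂ) (x : Completion E), Completion.extension w (a • x) =
      ‖a‖ * Completion.extension w x := by
    intro a x
    induction x using Completion.induction_on with
    | hp =>
      exact isClosed_eq (hcont.comp (continuous_const_smul a)) (continuous_const.mul hcont)
    | ih f => rw [← Completion.coe_smul, hcoe, hcoe, map_smul_eq_mul]
  refine ⟨Seminorm.of (Completion.extension w) hadd hsmul, hcont, hcoe, fun x => ?_⟩
  show Completion.extension w x ≤ c * ‖x‖
  induction x using Completion.induction_on with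
  | hp => exact isClosed_le hcont (continuous_const.mul continuous_norm)
  | ih f => rw [hcoe, Completion.norm_coe]; exact hwc f

/-- Finite `w`-nets of the unit ball of `E` give finite `ŵ`-nets of the unit ball of the
completion, for any seminorm `ŵ ≤ c ‖·‖` on `Ê` extending `w`. [folklore] -/
theorem exists_finset_completion_net (w : Seminorm ℂ E) (W : Seminorm ℂ (Completion E)) {c : ℝ}
    (hWw : ∀ f : E, W (f : Completion E) = w f) (hWc : ∀ x : Completion E, W x ≤ c * ‖x‖)
    (hnet : ∀ η : ℝ, 0 < η → ∃ F : Finset E, ∀ f : E, ‖f‖ ≤ 1 → ∃ g ∈ F, w (f - g) < η)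
    (η : ℝ) (hη : 0 < η) :
    ∃ F : Finset (Completion E), ∀ x : Completion E, ‖x‖ ≤ 1 → ∃ g ∈ F, W (x - g) < η := by
  classical
  obtain ⟨F, hF⟩ := hnet (η / 2) (half_pos hη)
  refine ⟨F.image ((↑) : E → Completion E), fun x hx => ?_⟩
  set c' : ℝ := max c 1 with hc'def
  have hc' : 0 < c' := lt_of_lt_of_le one_pos (le_max_right c 1)
  set δ : ℝ := η / (8 * c') with hδdef
  have hδ : 0 < δ := by positivity
  obtain ⟨f₁, hf₁⟩ := Completion.denseRange_coe.exists_dist_lt x hδ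
  rw [dist_eq_norm] at hf₁
  have hf₁n : ‖f₁‖ ≤ 1 + δ := by
    have h1 : ‖(f₁ : Completion E)‖ ≤ ‖x‖ + ‖x - f₁‖ := by
      calc ‖(f₁ : Completion E)‖ = ‖x - (x - f₁)‖ := by rw [sub_sub_cancel]
        _ ≤ ‖x‖ + ‖x - f₁‖ := norm_sub_le _ _
    rw [Completion.norm_coe] at h1
    linarith
  set f : E := (((1 + δ)⁻¹ : ℝ) : ℂ) • f₁ with hfdef
  have hf : ‖f‖ ≤ 1 := by
    rw [hfdef, norm_smul, Complex.norm_real, Real.norm_of_nonneg (by positivity),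
      inv_mul_le_iff₀ (by positivity), mul_one]
    exact hf₁n
  have hff₁ : ‖f₁ - f‖ ≤ δ := by
    have h1 : f₁ - f = (((1 - (1 + δ)⁻¹ : ℝ)) : ℂ) • f₁ := by
      rw [hfdef, Complex.ofReal_sub, sub_smul, Complex.ofReal_one, one_smul]
    have h2 : (1 - (1 + δ)⁻¹ : ℝ) = δ / (1 + δ) := by
      field_simp
      ring
    rw [h1, norm_smul, Complex.norm_real, h2, Real.norm_of_nonneg (by positivity)]
    calc δ / (1 + δ) * ‖f₁‖ ≤ δ / (1 + δ) * (1 + δ) := by gcongr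
      _ = δ := by field_simp
  obtain ⟨g, hg, hwg⟩ := hF f hf
  refine ⟨g, Finset.mem_image_of_mem _ hg, ?_⟩
  have h1 : W (x - g) ≤ W (x - f) + W ((f : Completion E) - g) := by
    calc W (x - g) = W ((x - f) + ((f : Completion E) - g)) := by rw [sub_add_sub_cancel]
      _ ≤ W (x - f) + W ((f : Completion E) - g) := map_add_le_add W _ _
  have h2 : W ((f : Completion E) - g) = w (f - g) := by rw [← Completion.coe_sub, hWw]
  have h3 : ‖x - f‖ ≤ 2 * δ := by
    calc ‖x - f‖ = ‖(x - f₁) + ((f₁ : Completion E) - f)‖ := by rw [sub_add_sub_cancel]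
      _ ≤ ‖x - f₁‖ + ‖(f₁ : Completion E) - f‖ := norm_add_le _ _
      _ ≤ δ + δ := add_le_add hf₁.le (by rw [← Completion.coe_sub, Completion.norm_coe]; exact hff₁)
      _ = 2 * δ := by ring
  have h4 : W (x - f) ≤ c' * (2 * δ) := by
    calc W (x - f) ≤ c * ‖x - f‖ := hWc _
      _ ≤ c' * ‖x - f‖ := mul_le_mul_of_nonneg_right (le_max_left c 1) (norm_nonneg _)
      _ ≤ c' * (2 * δ) := by gcongr
  have h5 : c' * (2 * δ) = η / 4 := by
    rw [hδdef]
    field_simp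
    ring
  linarith

end CompletionTransport

/-- **The Lasota–Yorke engine on a pre-Hilbert space.** Same conclusion as
`asymptoticCriticalLine_of_lasotaYorkeRealisation`, for data (weak seminorm `w ≤ c ‖·‖` with
finite `w`-nets of the unit ball, semigroup `T (t ≥ 0)`, a-priori Lasota–Yorke inequality at every
rate `ε > 0`, one-sided joint eigenvectors at all strip zeros of `ζ`) on a possibly INCOMPLETE
complex inner-product space `E`: everything is transported to the Hilbert completion `Ê` and the
landed engine is applied there. This lets the programme item `MeyerLasotaYorke`
(stmt-RiemannHypothesis-11050) be stated on Meyer's coinvariant space itself. [folklore] -/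
theorem asymptoticCriticalLine_of_lasotaYorkePreHilbert :
    ∀ (E : Type) (_ : NormedAddCommGroup E) (_ : InnerProductSpace ℂ E) (w : Seminorm ℂ E) (T : ℝ → E →L[ℂ] E) (t₀ c : ℝ), 0 < t₀ → (∀ f : E, w f ≤ c * ‖f‖) → (∀ s t : ℝ, 0 ≤ s → 0 ≤ t → T (s + t) = (T s).comp (T t)) → (∀ η : ℝ, 0 < η → ∃ F : Finset E, ∀ f : E, ‖f‖ ≤ 1 → ∃ g ∈ F, w (f - g) < η) → (∀ ε : ℝ, 0 < ε → ∃ C : ℝ, ∀ n : ℕ, ∃ R : ℝ, ∀ f : E, ‖(T t₀ ^ n) f‖ ≤ C * Real.exp ((n : ℝ) * ε * t₀) * ‖f‖ + R * w f) → (∀ s : ℂ, riemannZeta s = 0 → 0 < s.re → s.re < 1 → ∃ v : E, v ≠ 0 ∧ ∀ t : ℝ, 0 ≤ t → T t v = Complex.exp (↑t * (s - 1 / 2)) • v) → Summit.RiemannHypothesis.RiemannHypothesis.Theses.RuelleBand.AsymptoticCriticalLine := by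
  intro E _ _ w T t₀ c ht₀ hwc hT hnet hLY heig
  -- (2) the weak seminorm `W = ŵ` on the completion
  obtain ⟨W, hWcont, hWw, hWc⟩ := exists_seminorm_completion_extension w hwc
  -- (1) the operators `Tc t = T̂ t` on the completion and the semigroup law
  let ι : E →L[ℂ] Completion E := Completion.toComplL
  let Tc : ℝ → Completion E →L[ℂ] Completion E := fun t => (ι.comp (T t)).extend ι
  have hTcι : ∀ (t : ℝ) (f : E), Tc t (f : Completion E) = ((T t f : E) : Completion E) :=
    fun t f => completion_extend_coe (T t) f
  have hT' : ∀ s t : ℝ, 0 ≤ s → 0 ≤ t → Tc (s + t) = (Tc s).comp (Tc t) := by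
    intro s t hs ht
    refine clm_completion_eq_of_forall_coe fun f => ?_
    rw [ContinuousLinearMap.comp_apply, hTcι, hTcι, hTcι, hT s t hs ht,
      ContinuousLinearMap.comp_apply]
  -- (3) finite nets
  have hnet' : ∀ η : ℝ, 0 < η → ∃ F : Finset (Completion E), ∀ x : Completion E, ‖x‖ ≤ 1 →
      ∃ g ∈ F, W (x - g) < η :=
    exists_finset_completion_net w W hWw hWc hnet
  -- (4) the Lasota–Yorke inequality, same constants
  have hLY' : ∀ ε : ℝ, 0 < ε → ∃ C : ℝ, ∀ n : ℕ, ∃ R : ℝ, ∀ x : Completion E,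
      ‖(Tc t₀ ^ n) x‖ ≤ C * Real.exp ((n : ℝ) * ε * t₀) * ‖x‖ + R * W x := by
    intro ε hε
    obtain ⟨C, hC⟩ := hLY ε hε
    refine ⟨C, fun n => ?_⟩
    obtain ⟨R, hR⟩ := hC n
    refine ⟨R, fun x => ?_⟩
    induction x using Completion.induction_on with
    | hp =>
      exact isClosed_le (Tc t₀ ^ n).continuous.norm
        ((continuous_const.mul continuous_norm).add (continuous_const.mul hWcont))
    | ih f =>
      rw [completion_pow_coe (T t₀) (Tc t₀) (hTcι t₀) n f, Completion.norm_coe,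
        Completion.norm_coe, hWw]
      exact hR f
  -- (5) joint eigenvectors
  have heig' : ∀ s : ℂ, riemannZeta s = 0 → 0 < s.re → s.re < 1 →
      ∃ v : Completion E, v ≠ 0 ∧ ∀ t : ℝ, 0 ≤ t → Tc t v = Complex.exp (↑t * (s - 1 / 2)) • v := by
    intro s hs h0 h1
    obtain ⟨v, hv0, hv⟩ := heig s hs h0 h1
    refine ⟨(v : Completion E), fun h => hv0 ?_, fun t ht => ?_⟩
    · rw [← Completion.coe_zero] at h
      exact Completion.coe_injective E h
    · rw [hTcι, hv t ht, Completion.coe_smul]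
  -- (6) the engine on the completion
  exact asymptoticCriticalLine_of_lasotaYorkeRealisation (Completion E) inferInstance inferInstance
    inferInstance W Tc t₀ ht₀ hT' hnet' hLY' heig'

end Summit.RiemannHypothesis.RiemannHypothesis.Theorems

end
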